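import Summits.Ventures.PercRepro.C026GluingDefs

/-!
# The H-graph of a 3-terminal gluing, part A: the three events and the step transfer (p6, gen 8)

mine-3's composition theorem, lemma (L3) of the statement sheet (`proofs/MINE3-Q3-proof.md` §26.9).
For a gluing `G` (edges two-coloured by `side`, every non-mark one-coloured) and a `bot`
configuration `ω`, the three H-graph events of the D-free inequality are `HO1` (`c ~_H a` avoiding
`L = Com_b`), `HO2` (`c ~_H b` avoiding `K = Com_a`) and `HBad` (`a ~_H b`); this file has

* the symmetry of the H-graph (`HAdj.symm`, `HConn.symm`, `HConnAvoid.symm`) and Theorem B (d)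
  `hBad_of_hO1_hO2`;
* **(L3)** an H-step of a part is an H-step of `G` (`hAdj_of_part`); an H-step of `G` through an edge
  of colour `s` is an H-step of the part of colour `s` (`hAdj_part_of_closed` / `_cross`); an H-walk of
  a part reaching `v ≠ start` gives `v` an edge of its colour (`hasCol_of_hConn_part`), so an H-walk
  of `G` changes colour only at the marks; the general transfer `hAdj_part_of_hAdj` (a step out of a
  non-mark of colour `s` stays in the part of colour `s`) and the steps out of `c` and `a`.

`C026GluingH.lean` (part B) proves (L4) and (L5) from these.
-/

namespace PercRepro

namespace MultiGraph

section GluingH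

variable {V E : Type*}

/-- mine-3's `o1` in the H-graph form: `c ~_H a` in `H − L`. -/
def HO1 (G : MultiGraph V E) (ω : Config E) (a b c : V) : Prop :=
  G.HConnAvoid ω c (G.cluster ω b) c a

/-- mine-3's `o2` in the H-graph form: `c ~_H b` in `H − K`. -/
def HO2 (G : MultiGraph V E) (ω : Config E) (a b c : V) : Prop :=
  G.HConnAvoid ω c (G.cluster ω a) c b

/-- mine-3's `BAD` in the H-graph form: `a ~_H b`. -/
def HBad (G : MultiGraph V E) (ω : Config E) (a b c : V) : Prop := G.HConn ω c a b

/-- `o2` is `o1` with the marks `a` and `b` exchanged. -/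
theorem hO2_eq_hO1_swap (G : MultiGraph V E) (ω : Config E) (a b c : V) :
    G.HO2 ω a b c = G.HO1 ω b a c := rfl

variable {G : MultiGraph V E}

/-! ### Symmetry of the H-graph -/

/-- `Joins` is symmetric. -/
theorem Joins.symm {e : E} {x y : V} (h : G.Joins e x y) : G.Joins e y x := by
  rcases h with ⟨h1, h2⟩ | ⟨h1, h2⟩
  · exact Or.inr ⟨h1, h2⟩
  · exact Or.inl ⟨h1, h2⟩

/-- An H-step is symmetric. -/
theorem HAdj.symm {S : Config E} {c x y : V} (h : G.HAdj S c x y) : G.HAdj S c y x := by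
  rcases h with ⟨hx, hy, e, he, hj⟩ | ⟨hiff, e, hj⟩ | ⟨hx, hy, hc⟩
  · exact Or.inl ⟨hy, hx, e, he, hj.symm⟩
  · refine Or.inr (Or.inl ⟨⟨fun hy hx => hiff.mp hx hy, fun hx => ?_⟩, e, hj.symm⟩)
    by_contra hy
    exact hx (hiff.mpr hy)
  · exact Or.inr (Or.inr ⟨hy, hx, hc.symm⟩)

/-- H-connectivity is symmetric. -/
theorem HConn.symm {S : Config E} {c x y : V} (h : G.HConn S c x y) : G.HConn S c y x := by
  unfold HConn at h ⊢
  induction h with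
  | refl => exact Relation.ReflTransGen.refl
  | tail _ hxy ih => exact (Relation.ReflTransGen.single (HAdj.symm hxy)).trans ih

/-- Avoiding H-connectivity is symmetric. -/
theorem HConnAvoid.symm {S : Config E} {c : V} {X : Set V} {x y : V}
    (h : G.HConnAvoid S c X x y) : G.HConnAvoid S c X y x := by
  unfold HConnAvoid at h ⊢
  induction h with
  | refl => exact Relation.ReflTransGen.refl
  | tail _ hxy ih =>
    exact (Relation.ReflTransGen.single ⟨HAdj.symm hxy.1, hxy.2.2, hxy.2.1⟩).trans ih

/-- An avoiding H-walk is an H-walk. -/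
theorem HConnAvoid.hConn {S : Config E} {c : V} {X : Set V} {x y : V}
    (h : G.HConnAvoid S c X x y) : G.HConn S c x y := by
  unfold HConnAvoid at h
  unfold HConn
  induction h with
  | refl => exact Relation.ReflTransGen.refl
  | tail _ hxy ih => exact ih.tail hxy.1

/-- The end of an avoiding H-walk is outside `X`, unless the walk is trivial. -/
theorem HConnAvoid.notMem_or_eq {S : Config E} {c : V} {X : Set V} {x y : V}
    (h : G.HConnAvoid S c X x y) : y ∉ X ∨ y = x := by
  rcases Relation.ReflTransGen.cases_tail h with h | ⟨_, _, hzy⟩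
  · exact Or.inr h
  · exact Or.inl hzy.2.2

/-- **Theorem B (d)**: `o1 ∧ o2 ⇒ BAD` — the two walks concatenate at `c`. -/
theorem hBad_of_hO1_hO2 {ω : Config E} {a b c : V} (h1 : G.HO1 ω a b c) (h2 : G.HO2 ω a b c) :
    G.HBad ω a b c :=
  Relation.ReflTransGen.trans (HConn.symm (HConnAvoid.hConn h1)) (HConnAvoid.hConn h2)

/-! ### Marks under `IsBot`: the clusters `K`, `L`, `M` are pairwise disjoint -/

/-- No vertex lies in the clusters of two distinct marks. -/
theorem IsBot.not_mem_both {ω : Config E} {a b c : V} (hb : G.IsBot ω a b c) {m m' v : V}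
    (hm : m = a ∨ m = b ∨ m = c) (hm' : m' = a ∨ m' = b ∨ m' = c) (hne : m ≠ m')
    (h1 : v ∈ G.cluster ω m) (h2 : v ∈ G.cluster ω m') : False :=
  hb.not_conn_mark hm hm' hne (G.mem_cluster_of_mem_inter h1 h2)

/-- `IsBot` with `a` and `b` exchanged. -/
theorem IsBot.swap_ab {ω : Config E} {a b c : V} (hb : G.IsBot ω a b c) : G.IsBot ω b a c :=
  ⟨fun h => hb.1 h.symm, hb.2.2, hb.2.1⟩

/-- `IsGluing` with `a` and `b` exchanged. -/
theorem IsGluing.swap_ab {a b c : V} {side : E → Bool} (hg : G.IsGluing a b c side) :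
    G.IsGluing b a c side :=
  fun v hvb hva hvc => hg v hva hvb hvc

/-- A vertex outside a cluster of `G` is outside the cluster in every part. -/
theorem not_mem_cluster_part_of_not_mem {ω : Config E} {side : E → Bool} {s : Bool} {m v : V}
    (h : v ∉ G.cluster ω m) : v ∉ (G.part side s).cluster (sideRestrict ω side s) m :=
  fun h' => h (cluster_part_subset _ _ _ _ h')

/-! ### (L3) H-steps transfer between `G` and its parts -/

variable {a b c : V} {side : E → Bool} {ω : Config E}

/-- **(L3, part → `G`)** An H-step of a part is an H-step of `G`, unless it is trivial. -/
theorem hAdj_of_part (hg : G.IsGluing a b c side) (hb : G.IsBot ω a b c) {s : Bool} {x y : V}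
    (h : (G.part side s).HAdj (sideRestrict ω side s) c x y) : x = y ∨ G.HAdj ω c x y := by
  rcases h with ⟨hx, hy, e, he, hj⟩ | ⟨hiff, e, hj⟩ | ⟨hx, hy, hc⟩
  · exact Or.inr (Or.inl ⟨cluster_part_subset _ _ _ _ hx, cluster_part_subset _ _ _ _ hy, e.1, he, hj⟩)
  · have hj' : G.Joins e.1 x y := hj
    have hcx := (HasCol.of_joins (side := side) hj').1
    have hcy := (HasCol.of_joins (side := side) hj').2
    rw [e.2] at hcx hcy
    refine Or.inr (Or.inr (Or.inl ⟨?_, e.1, hj'⟩))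
    rw [mem_clusterC_iff_of_hasCol hg hb hcx, mem_clusterC_iff_of_hasCol hg hb hcy]
    exact hiff
  · by_cases hxy : x = y
    · exact Or.inl hxy
    · have hcy : G.HasCol side s y := hasCol_of_conn_part hc (Ne.symm hxy)
      have hcx : G.HasCol side s x := hasCol_of_conn_part hc.symm hxy
      refine Or.inr (Or.inr (Or.inr ⟨?_, ?_, Conn.of_part hc⟩))
      · rw [mem_clusterC_iff_of_hasCol hg hb hcx]
        exact hx
      · rw [mem_clusterC_iff_of_hasCol hg hb hcy]
        exact hy

/-- **(L3, `G` → part, clause 1)** A closed edge of colour `s` inside `M` is an H-step of the part. -/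
theorem hAdj_part_of_closed (hg : G.IsGluing a b c side) (hb : G.IsBot ω a b c) {s : Bool}
    {x y : V} {e : E} (hs : side e = s) (hx : x ∈ G.cluster ω c) (hy : y ∈ G.cluster ω c)
    (he : ω e = false) (hj : G.Joins e x y) :
    (G.part side s).HAdj (sideRestrict ω side s) c x y := by
  subst hs
  exact Or.inl ⟨(mem_clusterC_iff_of_hasCol hg hb (HasCol.of_joins (side := side) hj).1).mp hx,
    (mem_clusterC_iff_of_hasCol hg hb (HasCol.of_joins (side := side) hj).2).mp hy, ⟨e, rfl⟩, he, hj⟩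

/-- **(L3, `G` → part, clause 2)** An edge of colour `s` between `M` and `V ∖ M` is an H-step of the
part. -/
theorem hAdj_part_of_cross (hg : G.IsGluing a b c side) (hb : G.IsBot ω a b c) {s : Bool}
    {x y : V} {e : E} (hs : side e = s) (hiff : x ∈ G.cluster ω c ↔ y ∉ G.cluster ω c)
    (hj : G.Joins e x y) : (G.part side s).HAdj (sideRestrict ω side s) c x y := by
  subst hs
  refine Or.inr (Or.inl ⟨?_, ⟨e, rfl⟩, hj⟩)
  rw [← mem_clusterC_iff_of_hasCol hg hb (HasCol.of_joins (side := side) hj).1,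
    ← mem_clusterC_iff_of_hasCol hg hb (HasCol.of_joins (side := side) hj).2]
  exact hiff

/-- **(L3, `G` → part, clause 3)** Connectivity of the part outside `M_s` is an H-step of the part. -/
theorem hAdj_part_of_conn_part {s : Bool} {x y : V}
    (hx : x ∉ (G.part side s).cluster (sideRestrict ω side s) c)
    (hy : y ∉ (G.part side s).cluster (sideRestrict ω side s) c)
    (hc : (G.part side s).Conn (sideRestrict ω side s) x y) :
    (G.part side s).HAdj (sideRestrict ω side s) c x y :=
  Or.inr (Or.inr ⟨hx, hy, hc⟩)

/-- An H-step of the part of colour `s` between distinct vertices gives its target an edge of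
colour `s`. -/
theorem hasCol_of_hAdj_part {s : Bool} {x y : V}
    (h : (G.part side s).HAdj (sideRestrict ω side s) c x y) (hne : y ≠ x) :
    G.HasCol side s y := by
  rcases h with ⟨_, _, e, _, hj⟩ | ⟨_, e, hj⟩ | ⟨_, _, hc⟩
  · exact ⟨e.1, e.2, EdgeAt.of_joins_right (hj : G.Joins e.1 x y)⟩
  · exact ⟨e.1, e.2, EdgeAt.of_joins_right (hj : G.Joins e.1 x y)⟩
  · exact hasCol_of_conn_part hc hne

/-- **An H-walk of a part changes colour only at the marks**: a vertex `v ≠ u` reached from `u` by an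
H-walk of the part of colour `s` carries an edge of colour `s`. -/
theorem hasCol_of_hConn_part {s : Bool} {u v : V}
    (h : (G.part side s).HConn (sideRestrict ω side s) c u v) (hne : v ≠ u) :
    G.HasCol side s v := by
  unfold HConn at h
  induction h with
  | refl => exact absurd rfl hne
  | @tail x y _ hxy ih =>
    by_cases hyx : y = x
    · subst hyx
      exact ih hne
    · exact hasCol_of_hAdj_part hxy hyx

/-- The avoiding form of `hasCol_of_hConn_part`. -/
theorem hasCol_of_hConnAvoid_part {s : Bool} {X : Set V} {u v : V}
    (h : (G.part side s).HConnAvoid (sideRestrict ω side s) c X u v) (hne : v ≠ u) :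
    G.HasCol side s v :=
  hasCol_of_hConn_part (HConnAvoid.hConn h) hne

/-- **(L3, the general transfer)** An H-step of `G` from a non-mark `v` of colour `s`, outside `L`,
to a vertex outside `K`, is a (possibly trivial) H-step of the part of colour `s`. -/
theorem hAdj_part_of_hAdj (hg : G.IsGluing a b c side) (hb : G.IsBot ω a b c) {s : Bool}
    {v w : V} (hcv : G.HasCol side s v) (hva : v ≠ a) (hvb : v ≠ b) (hvc : v ≠ c)
    (hvL : v ∉ G.cluster ω b) (hwK : w ∉ G.cluster ω a) (hvw : G.HAdj ω c v w) :
    v = w ∨ (G.part side s).HAdj (sideRestrict ω side s) c v w := by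
  rcases hvw with ⟨hvM, hwM, e, he, hj⟩ | ⟨hiff, e, hj⟩ | ⟨hvM, hwM, hconn⟩
  · have hs : side e = s := hg.eq_of_hasCol hva hvb hvc (HasCol.of_joins (side := side) hj).1 hcv
    exact Or.inr (hAdj_part_of_closed hg hb hs hvM hwM he hj)
  · have hs : side e = s := hg.eq_of_hasCol hva hvb hvc (HasCol.of_joins (side := side) hj).1 hcv
    exact Or.inr (hAdj_part_of_cross hg hb hs hiff hj)
  · by_cases hvw : v = w
    · exact Or.inl hvw
    · have hvK : v ∉ G.cluster ω a := fun h => hwK ((h : G.Conn ω a v).trans hconn)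
      have hu : ∀ m, (m = a ∨ m = b ∨ m = c) → ¬ G.Conn ω m v := by
        rintro m (rfl | rfl | rfl)
        · exact hvK
        · exact hvL
        · exact hvM
      obtain ⟨s', hs'⟩ := (conn_rest_iff hg hu w).mp hconn
      have hcv' : G.HasCol side s' v := hasCol_of_conn_part hs'.symm hvw
      have : s' = s := hg.eq_of_hasCol hva hvb hvc hcv' hcv
      subst this
      exact Or.inr (hAdj_part_of_conn_part (not_mem_cluster_part_of_not_mem hvM)
        (not_mem_cluster_part_of_not_mem hwM) hs')

/-- An H-step of `G` out of `c` is an H-step of the part of the colour of its edge. -/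
theorem hAdj_part_of_hAdj_c (hg : G.IsGluing a b c side) (hb : G.IsBot ω a b c) {w : V}
    (hvw : G.HAdj ω c c w) : ∃ s, (G.part side s).HAdj (sideRestrict ω side s) c c w := by
  rcases hvw with ⟨hcM, hwM, e, he, hj⟩ | ⟨hiff, e, hj⟩ | ⟨hcM, _, _⟩
  · exact ⟨side e, hAdj_part_of_closed hg hb rfl hcM hwM he hj⟩
  · exact ⟨side e, hAdj_part_of_cross hg hb rfl hiff hj⟩
  · exact absurd (Conn.refl _ _ _) hcM

/-- An H-step of `G` out of `a` to a vertex outside `K` is an H-step of the part of the colour of its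
edge. -/
theorem hAdj_part_of_hAdj_a (hb : G.IsBot ω a b c) (hg : G.IsGluing a b c side) {w : V}
    (hac : a ≠ c) (hwK : w ∉ G.cluster ω a) (hvw : G.HAdj ω c a w) :
    ∃ s, (G.part side s).HAdj (sideRestrict ω side s) c a w := by
  rcases hvw with ⟨haM, _, _, _, _⟩ | ⟨hiff, e, hj⟩ | ⟨_, _, hconn⟩
  · exact absurd haM (hb.not_mem_cluster_mark (Or.inr (Or.inr rfl)) (Or.inl rfl) hac.symm)
  · exact ⟨side e, hAdj_part_of_cross hg hb rfl hiff hj⟩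
  · exact absurd hconn hwK

end GluingH

end MultiGraph

end PercRepro
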